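import Literature.Analysis.FluidPDE.AxisymNoSwirlCoSignedFlux
import HarnessLib

/-!
# Axisymmetric flows without swirl: the time balance of a weighted vorticity functional
# `∫ φ(x) Ω(t, x) dx` in Tao's class (step of Gallay–Šverák 2015, Lemma 6.4)

Analysis/FluidPDE proof file (theorems only) on the discharge path of the named fact
`Literature.Analysis.FluidPDE.GallaySverak2015.ImpulseConservation`
(`AxisymNoSwirlScaleInvariantBounds.lean`; Th. Gallay, V. Šverák, Confluentes Math. 7 (2015)
67–92 = arXiv:1510.01036, §6 Lemma 6.4: conservation of the impulse `∫ r²ω_θ dr dz`).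

The printed proof differentiates `t ↦ ∫ r²η(t) dx` in time.  In the tree's smooth class one
integrates instead the time-line derivatives of a *bounded* weighted functional: for a Tao-class
solution `v` on `[0, T]` with axisymmetric slices, `Ω = angVortQuot (v ·) = ω_θ/r`, and a
continuous square-integrable weight `φ`,

`∫ φ Ω(b) dx = ∫ φ Ω(0) dx + ∫_{t ∈ (0,b)} ∫ φ ∂ₜΩ(t) dx dt`, `b ∈ (0, T]`

(`IsTaoSolutionOn.integral_weight_mul_angVortQuot_eq_add`).  This is the tree's balance lemma
`integral_comp_eq_add_of_ae_hasDerivAt` (Gallay–Šverák §5, time integration of (5.1)) with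
`Φ = id` and the family `φ(x)Ω(t,x)`: the time lines are smooth
(`IsSmoothSpaceTimeOn.angVortQuot_family`, `…timeDerivWithin_angVortQuot`), the integrand
`φ ∂ₜΩ` is jointly measurable and bounded in `L¹` uniformly in time by
`‖φ‖₂² + sup_t ‖∂ₜΩ(t)‖₂²` (`IsTaoSolutionOn.exists_lintegral_sq_quot_le`).  Combined with the
weighted slice identity (`AxisymNoSwirlImpulseSlice`) for the weights `φ = r²(1 + ε|x|²)⁻²` and
the limit `ε → 0` it yields the conservation of `∫ r²η`.

## References

* Th. Gallay, V. Šverák, Confluentes Math. 7 (2015) 67–92, arXiv:1510.01036, §6 Lemma 6.4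
  (arXiv p. 19), §5 proof of Lemma 5.1 (time integration, arXiv p. 16). [`GallaySverak2016`]
-/

noncomputable section

open MeasureTheory Set Function Filter
open _root_.Topology
open scoped NNReal ENNReal

namespace Literature.Analysis.FluidPDE

/-- Local notation for physical space `ℝ³ = EuclideanSpace ℝ (Fin 3)`. -/
local notation "ℝ³" => EuclideanSpace ℝ (Fin 3)

/-- `ab ≤ a² + b²` in `ℝ≥0∞`. [folklore] -/
private theorem ennreal_mul_le_sq_add_sq₂ (a b : ℝ≥0∞) : a * b ≤ a ^ 2 + b ^ 2 := by
  rcases le_total a b with hab | hab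
  · calc a * b ≤ b * b := by gcongr
      _ = b ^ 2 := (sq b).symm
      _ ≤ a ^ 2 + b ^ 2 := le_add_self
  · calc a * b ≤ a * a := by gcongr
      _ = a ^ 2 := (sq a).symm
      _ ≤ a ^ 2 + b ^ 2 := le_self_add

variable {T ν : ℝ} {u₀ : ℝ³ → ℝ³} {v : ℝ → ℝ³ → ℝ³} {q : ℝ → ℝ³ → ℝ}

/-- **Time balance of a weighted vorticity functional in Tao's class.**  Let `(v, q)` be a
Tao-class solution on `[0, T]` (`IsTaoSolutionOn T ν u₀ v q`, `0 < T`) with axisymmetric slices,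
`Ω(t) = angVortQuot (v t) = ω_θ/r`, and let `φ : ℝ³ → ℝ` be continuous with `∫ |φ|² ≤ P < ∞`.
Then for every `b ∈ (0, T]`:
`∫ φ Ω(b) dx = ∫ φ Ω(0) dx + ∫_{t ∈ (0, b)} ∫ φ(x) · angVortQuot (∂ₜv(t)) (x) dx dt`
(`∂ₜv = timeDerivWithin (Icc 0 T) v`; `angVortQuot (∂ₜv t) = ∂ₜΩ(t)` by
`IsSmoothSpaceTimeOn.timeDerivWithin_angVortQuot`).  The time-integrated form of
`d/dt ∫ φ η dx = ∫ φ ∂ₜη dx` used (with `φ → r²`) in the proof of Lemma 6.4.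
[cite: GallaySverak2016, §6 proof of Lemma 6.4 (arXiv p. 19); §5 proof of Lemma 5.1 (arXiv p. 16)] -/
theorem IsTaoSolutionOn.integral_weight_mul_angVortQuot_eq_add (h : IsTaoSolutionOn T ν u₀ v q)
    (hT : 0 < T) (hax : ∀ t ∈ Icc 0 T, IsAxisymmetric (v t))
    {φ : ℝ³ → ℝ} (hφc : Continuous φ) {P : ℝ≥0} (hφP : ∫⁻ x, ‖φ x‖ₑ ^ 2 ≤ P)
    {b : ℝ} (hb : b ∈ Ioc 0 T) :
    ∫ x, φ x * angVortQuot (v b) x = (∫ x, φ x * angVortQuot (v 0) x) +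
      ∫ t in Ioo 0 b, ∫ x, φ x * angVortQuot (timeDerivWithin (Icc 0 T) v t) x := by
  have hU : UniqueDiffOn ℝ (Icc 0 T) := uniqueDiffOn_Icc hT
  have hcl := Icc_subset_closure_interior_Icc' hT
  have hsm : IsSmoothSpaceTimeOn (Icc 0 T) v := h.classical.smooth_velocity
  -- the jointly smooth family `Ω` and its time derivative
  have hΩ : IsSmoothSpaceTimeOn (Icc 0 T) (fun t => angVortQuot (v t)) :=
    hsm.angVortQuot_family (convex_Icc 0 T) hU
  have hΩ' : IsSmoothSpaceTimeOn (Icc 0 T) (timeDerivWithin (Icc 0 T) fun t => angVortQuot (v t)) :=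
    hΩ.timeDerivWithin hU
  have hdt : ∀ t ∈ Icc 0 T, ∀ x, timeDerivWithin (Icc 0 T) (fun s => angVortQuot (v s)) t x =
      angVortQuot (timeDerivWithin (Icc 0 T) v t) x := fun t ht x =>
    hsm.timeDerivWithin_angVortQuot (convex_Icc 0 T) hU hcl hax ht x
  -- time lines of jointly continuous fields are continuous
  have tl : ∀ {w : ℝ → ℝ³ → ℝ},
      ContinuousOn (uncurry w) (Icc 0 T ×ˢ univ) → ∀ x, ContinuousOn (fun s => w s x) (Icc 0 T) := by
    intro w hw x
    exact hw.comp (continuous_id.prodMk continuous_const).continuousOn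
      fun s hs => mk_mem_prod hs (mem_univ x)
  -- uniform `L²` bounds of `Ω`, `∂ₜΩ`, and `φ ∈ L²`
  obtain ⟨C, hC⟩ := h.exists_lintegral_sq_quot_le hT hax
  have hφm : MemLp φ 2 volume := memLp_two_of_lintegral_sq_le_coe hφc hφP
  -- (1) time lines
  have hline : ∀ᵐ x ∂(volume : Measure ℝ³),
      ContinuousOn (fun t => φ x * angVortQuot (v t) x) (Icc 0 T) ∧
      ContinuousOn (fun t => φ x * angVortQuot (timeDerivWithin (Icc 0 T) v t) x) (Icc 0 T) ∧
      ∀ t ∈ Ioo 0 T, HasDerivAt (fun t => φ x * angVortQuot (v t) x)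
        (φ x * angVortQuot (timeDerivWithin (Icc 0 T) v t) x) t := by
    refine ae_of_all _ fun x => ⟨continuousOn_const.mul (tl hΩ.continuousOn x),
      continuousOn_const.mul ((tl hΩ'.continuousOn x).congr fun s hs => (hdt s hs x).symm),
      fun t ht => ?_⟩
    have htI : t ∈ Icc 0 T := Ioo_subset_Icc_self ht
    have h1 : HasDerivWithinAt (fun s => angVortQuot (v s) x)
        (timeDerivWithin (Icc 0 T) (fun s => angVortQuot (v s)) t x) (Icc 0 T) t := by
      rw [timeDerivWithin_apply]
      exact (hΩ.differentiableWithinAt_time htI x).hasDerivWithinAt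
    rw [hdt t htI x] at h1
    exact (h1.hasDerivAt (Icc_mem_nhds ht.1 ht.2)).const_mul (φ x)
  -- (2) joint measurability of `φ ∂ₜΩ` from continuity off the axis
  have hmeas : AEStronglyMeasurable (uncurry fun t x => deriv (fun y : ℝ => y)
      (φ x * angVortQuot (v t) x) * (φ x * angVortQuot (timeDerivWithin (Icc 0 T) v t) x))
      ((volume.restrict (Ioo 0 T)).prod volume) := by
    refine aestronglyMeasurable_prod_of_continuousOn_off_axis ?_
    have hsub : Ioo 0 T ×ˢ {x : ℝ³ | cylRadius x ≠ 0} ⊆ Icc 0 T ×ˢ univ :=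
      prod_mono Ioo_subset_Icc_self (subset_univ _)
    have c1 : ContinuousOn (fun p : ℝ × ℝ³ => φ p.2) (Icc 0 T ×ˢ univ) :=
      (hφc.comp continuous_snd).continuousOn
    have c2 : ContinuousOn (uncurry (timeDerivWithin (Icc 0 T) fun t => angVortQuot (v t)))
        (Icc 0 T ×ˢ univ) := hΩ'.continuousOn
    refine ((c1.mul c2).mono hsub).congr fun p hp => ?_
    obtain ⟨t, x⟩ := p
    have htI : t ∈ Icc 0 T := Ioo_subset_Icc_self hp.1
    simp only [uncurry_apply_pair, deriv_id'', one_mul, Pi.mul_apply]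
    rw [hdt t htI x]
  -- (3) uniform `L¹` bound of `φ ∂ₜΩ`
  have hbound : ∀ t ∈ Ioo 0 T, ∫⁻ x, ‖deriv (fun y : ℝ => y) (φ x * angVortQuot (v t) x) *
      (φ x * angVortQuot (timeDerivWithin (Icc 0 T) v t) x)‖ₑ ≤ (P : ℝ≥0∞) + C := by
    intro t ht
    have htI : t ∈ Icc 0 T := Ioo_subset_Icc_self ht
    obtain ⟨-, hΩ'C, -, -⟩ := hC t htI
    calc ∫⁻ x, ‖deriv (fun y : ℝ => y) (φ x * angVortQuot (v t) x) *
          (φ x * angVortQuot (timeDerivWithin (Icc 0 T) v t) x)‖ₑ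
        ≤ ∫⁻ x, (‖φ x‖ₑ ^ 2 + ‖angVortQuot (timeDerivWithin (Icc 0 T) v t) x‖ₑ ^ 2) := by
          refine lintegral_mono fun x => ?_
          rw [deriv_id'', one_mul, enorm_mul]
          exact ennreal_mul_le_sq_add_sq₂ _ _
      _ = (∫⁻ x, ‖φ x‖ₑ ^ 2) + ∫⁻ x, ‖angVortQuot (timeDerivWithin (Icc 0 T) v t) x‖ₑ ^ 2 :=
          lintegral_add_left (hφc.measurable.enorm.pow_const 2) _
      _ ≤ (P : ℝ≥0∞) + C := add_le_add hφP hΩ'C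
  -- (4) the slices `φ Ω(t)` are integrable
  have hint : ∀ t ∈ Icc 0 T, Integrable (fun x => (fun y : ℝ => y) (φ x * angVortQuot (v t) x)) :=
    fun t ht => hφm.integrable_mul (h.memLp_angVortQuot_data hax ht).1
  have key := integral_comp_eq_add_of_ae_hasDerivAt (μ := (volume : Measure ℝ³)) (T := T)
    (Φ := fun y : ℝ => y) (g := fun t x => φ x * angVortQuot (v t) x)
    (g' := fun t x => φ x * angVortQuot (timeDerivWithin (Icc 0 T) v t) x) contDiff_id hline
    hmeas (by simp) hbound hint hb
  simp only [deriv_id'', one_mul] at key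
  exact key

/-- **Corollary (constant weighted functional).**  In the situation of
`IsTaoSolutionOn.integral_weight_mul_angVortQuot_eq_add`, if the slice pairing
`∫ φ · angVortQuot (∂ₜv(t)) dx` vanishes for every `t ∈ (0, T)`, then `∫ φ Ω(b) = ∫ φ Ω(0)` for
all `b ∈ [0, T]`. [cite: GallaySverak2016, §6 proof of Lemma 6.4 (arXiv p. 19)] -/
theorem IsTaoSolutionOn.integral_weight_mul_angVortQuot_eq_of_slice_zero
    (h : IsTaoSolutionOn T ν u₀ v q) (hT : 0 < T) (hax : ∀ t ∈ Icc 0 T, IsAxisymmetric (v t))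
    {φ : ℝ³ → ℝ} (hφc : Continuous φ) {P : ℝ≥0} (hφP : ∫⁻ x, ‖φ x‖ₑ ^ 2 ≤ P)
    (hzero : ∀ t ∈ Ioo 0 T, ∫ x, φ x * angVortQuot (timeDerivWithin (Icc 0 T) v t) x = 0)
    {b : ℝ} (hb : b ∈ Icc 0 T) :
    ∫ x, φ x * angVortQuot (v b) x = ∫ x, φ x * angVortQuot (v 0) x := by
  rcases hb.1.eq_or_lt with hb0 | hb0
  · rw [← hb0]
  rw [h.integral_weight_mul_angVortQuot_eq_add hT hax hφc hφP ⟨hb0, hb.2⟩,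
    setIntegral_congr_fun measurableSet_Ioo fun t ht => hzero t ⟨ht.1, ht.2.trans_le hb.2⟩,
    integral_zero, add_zero]

end Literature.Analysis.FluidPDE

end
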